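import Literature.Analysis.FluidPDE.ConvolutionLaplacian
import Literature.Analysis.FluidPDE.NormalisedPressureDischarge
import Literature.Analysis.FluidPDE.RieszPressureL3
import HarnessLib

/-!
# The harmonic part of the pressure of a classical solution with `L³` slices

Analysis/FluidPDE proofs file (theorems only), first half of the `L³` twin of Tao's
pressure-normalisation lemma (Tao 2011 = arXiv:1108.1165, Lemma 4.1 (i); finite-energy version
proved in `NormalisedPressureDischarge.lean`), on the discharge path of
`Literature.Analysis.FluidPDE.chaeWolf2017_dss_typeI_decay` (Chae–Wolf 2017, Thm. 1.1, whose
solutions are classical with slices in `C((−∞,0); L³)` and an *a priori arbitrary* smooth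
pressure; the Calderón–Zygmund step "(2.4b) `‖π(t)‖_{p/2} ≤ C‖u(t)‖²_p`" of its proof, arXiv
p. 5, presupposes that the pressure IS the Riesz pressure, which is what the normalisation lemma
supplies).

Let `(u, p)` be a classical solution of the unforced Navier–Stokes system on an open time set
`S` and let the slice `u(t) ∈ L³(ℝ³)`, `t ∈ S`. With the tree's Riesz pressure
`Π[u(t)] ∈ L^{3/2}` (`rieszPressure`, `RieszPressureL3.lean`) put `g(t) = p(t) − Π[u(t)]`
(locally integrable). This file proves:

* `integral_harmonicPart_mul_laplacian` — `g(t)` is harmonic in the sense of distributions,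
  `∫ g(t) Δψ = 0` for test functions `ψ` (pressure Poisson equation `Δp = −∂ᵢ∂ⱼ(uᵢuⱼ)`,
  `laplacian_pressure_eq_of_isClassicalNSSolutionOn`, against the weak Poisson equation of the
  Riesz pressure, `integral_rieszPressure_mul_laplacian`);
* `harmonicOnNhd_mollified_harmonicPart` — every mollification `θ ⋆ g(t)` is harmonic on `ℝ³`
  (`ConvolutionLaplacian.harmonicOnNhd_convolution`);
* the combined test functions `Φ = χ_R ⋆ θ` (`χ_R = probeBump R` the unit-mass radial probe of
  `HarmonicProbe.lean`, `θ` a normed bump of outer radius `≤ 1`): smoothness, support in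
  `‖y‖ ≤ 2R + 1`, and the size bounds `|Φ| ≤ (mR³)⁻¹`, `‖DΦ‖ ≤ C₁(mR³)⁻¹R⁻¹`,
  `|ΔΦ| ≤ C₂(mR³)⁻¹R⁻²` inherited from `χ_R`;
* `fderiv_mollified_harmonicPart_eq` — **the probe identity** (Tao's computation of
  `∫∫ ∇h χ_R`, here for the mollified harmonic part): for `R > 0`, `x₀`, `a`,
  `∂ₐ(θ ⋆ g(t))(x₀) = ν∫⟪u, ΔΨ⟫ + ∫⟪u, (u·∇)Ψ⟫ − ∫⟪∂ₜu, Ψ⟫ − ∫ ∂ₐΦ(y) Π[u(t)](x₀ − y) dy`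
  with `Ψ(y) = Φ(x₀ − y) a` (mean-value formula for the gradient of the harmonic function
  `θ ⋆ g(t)` at scale `R`, associativity `(∂ₐχ_R ⋆ θ) ⋆ g = ∂ₐχ_R ⋆ (θ ⋆ g)`, one integration by
  parts moving `∂ₐ` onto `p`, the momentum equation, Green's identity for the viscous term and
  the trilinear identity with `div u = 0` for the transport term — exactly as in
  `NormalisedPressureDischarge.fderiv_harmonicPart_eq`, with `Φ` in place of `χ_R`).

The bounds of the four terms and the conclusion `∇(θ ⋆ g(t)) = 0`, `p(t) = Π[u(t)] + C(t)` a.e.,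
are in `PressureNormalisationL3.lean`.

## Mathlib / tree search

Tree: `rieszPressure`, `memLp_rieszPressure`, `integral_rieszPressure_mul_laplacian`
(`RieszPressureL3`); `laplacian_pressure_eq_of_isClassicalNSSolutionOn` (`PressurePoisson`);
`pressureSource_eq_of_isDivFree`, `integral_mul_pressureSource` (`PressureRepresentation`);
`integral_mul_laplacian_comm` (`NewtonPotential`); `probeBump`, `fderiv_harmonic_eq_integral_probeBump`,
`integral_fderiv_mul_comp_sub`, `abs_probeBump_le`, `norm_fderiv_probeBump_le`,
`abs_laplacian_probeBump_le`, `probeBump_eq_zero`, `fderiv_comp_const_sub`,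
`laplacian_comp_const_sub` (`HarmonicProbe`); `integral_inner_laplacian_comm`,
`integral_inner_convect_add_eq_zero`, `integrable_inner_of_hasCompactSupport_right`
(`ClassicalSolutionCalculus`, `WholeSpaceIBP`); `ConvolutionLaplacian.*` (this discharge path).
Mathlib: `HasCompactSupport.contDiff_convolution_left`, `HasCompactSupport.convolution`,
`HasCompactSupport.convolutionExists_left`, `ContDiffBump.normed` API.

## References

* T. Tao, *Localisation and compactness properties of the Navier–Stokes global regularity
  problem*, Anal. PDE 6 (2013) 25–107 = arXiv:1108.1165, §4, Lemma 4.1 (i) and its proof.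
  [Tao2011]
* D. Chae, J. Wolf, Comm. PDE 42 (2017) = arXiv:1610.09464, §2, (2.4b) (arXiv p. 5).
  [ChaeWolf2017RemovingDSS]
-/

noncomputable section

open MeasureTheory Set Filter Metric Function ContinuousLinearMap
open scoped Topology Laplacian ContDiff Convolution InnerProductSpace RealInnerProductSpace ENNReal

namespace Literature.Analysis.FluidPDE

namespace PressureNormalisationL3

variable {S : Set ℝ} {ν : ℝ} {u : ℝ → (EuclideanSpace ℝ (Fin 3)) → (EuclideanSpace ℝ (Fin 3))} {p : ℝ → (EuclideanSpace ℝ (Fin 3)) → ℝ}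

/-- `1 ≤ 3/2` in `ℝ≥0∞` (the exponent of the Riesz pressure is at least `1`). [folklore] -/
private theorem one_le_three_halves : (1 : ℝ≥0∞) ≤ 3 / 2 :=
  ((ENNReal.lt_div_iff_mul_lt (Or.inl (by norm_num)) (Or.inl (by norm_num))).2 (by norm_num)).le

/-! ### The harmonic part `g(t) = p(t) − Π[u(t)]` -/

/-- The harmonic part `p(t) − Π[u(t)]` of the pressure is locally integrable (continuous minus
`L^{3/2}`). [folklore] -/
theorem locallyIntegrable_harmonicPart (h : IsClassicalNSSolutionOn S ν 0 u p) {t : ℝ}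
    (ht : t ∈ S) (h3 : MemLp (u t) 3 volume) :
    LocallyIntegrable (fun x => p t x - rieszPressure (u t) x) volume :=
  (h.contDiff_pressure ht).continuous.locallyIntegrable.sub
    ((memLp_rieszPressure h3).locallyIntegrable one_le_three_halves)

/-- **The harmonic part is harmonic in the sense of distributions**: for a classical solution of
the unforced system on an open time set `S`, `t ∈ S` with `u(t) ∈ L³`, and every smooth compactly
supported `ψ`, `∫ (p(t) − Π[u(t)]) Δψ = 0` — both `p(t)` (pressure Poisson equation, Tao 2011 (8))
and `Π[u(t)]` (weak Poisson equation of the Riesz pressure) have Laplacian `−∂ᵢ∂ⱼ(uᵢuⱼ)` in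
`𝒟'`. [cite: Tao2011, §4, proof of Lemma 4.1 (i)] -/
theorem integral_harmonicPart_mul_laplacian (h : IsClassicalNSSolutionOn S ν 0 u p)
    (hS : IsOpen S) {t : ℝ} (ht : t ∈ S) (h3 : MemLp (u t) 3 volume) {ψ : (EuclideanSpace ℝ (Fin 3)) → ℝ}
    (hψ : ContDiff ℝ ∞ ψ) (hψc : HasCompactSupport ψ) :
    ∫ x, (p t x - rieszPressure (u t) x) * (Δ ψ) x = 0 := by
  have hti : t ∈ interior S := by rwa [hS.interior_eq]
  have hu : ContDiff ℝ ∞ (u t) := h.contDiff_velocity ht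
  have hp : ContDiff ℝ ∞ (p t) := h.contDiff_pressure ht
  have hu2 : ContDiff ℝ 2 (u t) := contDiff_infty.1 hu 2
  have hp2 : ContDiff ℝ 2 (p t) := contDiff_infty.1 hp 2
  have hψ2 : ContDiff ℝ 2 ψ := contDiff_infty.1 hψ 2
  have hΔψc : Continuous (Δ ψ) := FluidPDE.continuous_laplacian hψ2
  have hΔψs : HasCompactSupport (Δ ψ) := hψc.mono' fun x hx => by
    contrapose! hx
    simp [FluidPDE.laplacian_eq_zero_of_notMem_tsupport hx]
  -- the pressure Poisson equation `Δ p = -G[u]`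
  have hPoisson : ∀ x, (Δ (p t)) x = -pressureSource (u t) x := fun x => by
    rw [laplacian_pressure_eq_of_isClassicalNSSolutionOn h hti x,
      pressureSource_eq_of_isDivFree (h.divFree t ht)]
    have : VectorCalculus.divergence ((0 : ℝ → (EuclideanSpace ℝ (Fin 3)) → (EuclideanSpace ℝ (Fin 3))) t) x = 0 := by
      simp [VectorCalculus.divergence]
    rw [this, add_zero]
  -- `∫ p Δψ = ∫ ψ Δp = -∫ ψ G[u] = -∫ D²ψ(u, u)`
  have h1 : ∫ x, p t x * (Δ ψ) x = -∫ x, fderiv ℝ (fderiv ℝ ψ) x (u t x) (u t x) := by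
    have e1 : ∫ x, p t x * (Δ ψ) x = ∫ x, (Δ ψ) x * p t x :=
      integral_congr_ae (Eventually.of_forall fun x => mul_comm _ _)
    rw [e1, ← integral_mul_laplacian_comm hp2 hψ2 hψc, ← integral_mul_pressureSource hψ2 hψc hu2,
      ← integral_neg]
    refine integral_congr_ae (Eventually.of_forall fun x => ?_)
    show ψ x * (Δ (p t)) x = -(ψ x * pressureSource (u t) x)
    rw [hPoisson x]
    ring
  -- `∫ Π Δψ = -∫ D²ψ(u, u)`
  have h2 : ∫ x, rieszPressure (u t) x * (Δ ψ) x = -∫ x, fderiv ℝ (fderiv ℝ ψ) x (u t x) (u t x) :=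
    integral_rieszPressure_mul_laplacian h3 hψ hψc
  -- integrability, to split the difference
  have i1 : Integrable fun x => p t x * (Δ ψ) x :=
    (hp.continuous.mul hΔψc).integrable_of_hasCompactSupport hΔψs.mul_left
  have i2 : Integrable fun x => rieszPressure (u t) x * (Δ ψ) x := by
    have hK : IsCompact (tsupport (Δ ψ)) := hΔψs
    have hon : IntegrableOn (fun x => rieszPressure (u t) x * (Δ ψ) x) (tsupport (Δ ψ)) :=
      (((memLp_rieszPressure h3).locallyIntegrable one_le_three_halves).integrableOn_isCompact hK)
        |>.mul_continuousOn hΔψc.continuousOn hK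
    exact (integrableOn_iff_integrable_of_support_subset
      ((support_mul_subset_right _ _).trans (subset_tsupport _))).1 hon
  have e : ∫ x, (p t x - rieszPressure (u t) x) * (Δ ψ) x =
      ∫ x, (p t x * (Δ ψ) x - rieszPressure (u t) x * (Δ ψ) x) :=
    integral_congr_ae (Eventually.of_forall fun x => sub_mul _ _ _)
  rw [e, integral_sub i1 i2, h1, h2, sub_self]

/-- **Every mollification of the harmonic part is harmonic on `ℝ³`** (`θ` smooth with compact
support; `ConvolutionLaplacian.harmonicOnNhd_convolution`). [cite: Tao2011, §4, proof of Lemma 4.1 (i)] -/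
theorem harmonicOnNhd_mollified_harmonicPart (h : IsClassicalNSSolutionOn S ν 0 u p)
    (hS : IsOpen S) {t : ℝ} (ht : t ∈ S) (h3 : MemLp (u t) 3 volume) {θ : (EuclideanSpace ℝ (Fin 3)) → ℝ}
    (hθ : ContDiff ℝ ∞ θ) (hθc : HasCompactSupport θ) :
    InnerProductSpace.HarmonicOnNhd (θ ⋆ fun x => p t x - rieszPressure (u t) x) univ :=
  ConvolutionLaplacian.harmonicOnNhd_convolution (locallyIntegrable_harmonicPart h ht h3)
    (fun _ hψ hψc => integral_harmonicPart_mul_laplacian h hS ht h3 hψ hψc) hθ hθc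

/-! ### The combined test functions `Φ = χ_R ⋆ θ` -/

section TestFunction

variable (φ : ContDiffBump (0 : (EuclideanSpace ℝ (Fin 3)))) {R : ℝ}

/-- `Φ = χ_R ⋆ θ` is smooth. [folklore] -/
theorem contDiff_probeConv (hR : 0 < R) {n : ℕ∞} : ContDiff ℝ n (probeBump R ⋆ φ.normed volume) :=
  (hasCompactSupport_probeBump hR).contDiff_convolution_left _ (contDiff_probeBump R)
    φ.continuous_normed.locallyIntegrable

/-- `Φ = χ_R ⋆ θ` has compact support (`R > 0`). [folklore] -/
theorem hasCompactSupport_probeConv (hR : 0 < R) :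
    HasCompactSupport (probeBump R ⋆ φ.normed volume) :=
  (hasCompactSupport_probeBump hR).convolution _ φ.hasCompactSupport_normed

/-- The normed bump vanishes off the closed ball of radius `rOut`. [folklore] -/
theorem normed_eq_zero_of_lt {z : (EuclideanSpace ℝ (Fin 3))} (hz : φ.rOut < ‖z‖) : φ.normed volume z = 0 := by
  have : z ∉ Function.support (φ.normed volume) := by
    rw [φ.support_normed_eq, mem_ball_zero_iff]
    exact not_lt.2 hz.le
  simpa [Function.mem_support] using this

/-- `χ_R` vanishes off the closed ball of radius `2R` (strict form). [folklore] -/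
theorem probeBump_eq_zero_of_lt (hR : 0 < R) {z : (EuclideanSpace ℝ (Fin 3))} (hz : 2 * R < ‖z‖) : probeBump R z = 0 :=
  probeBump_eq_zero hR hz.le

/-- **`∂ₐΦ = (∂ₐχ_R) ⋆ θ`.** [folklore] -/
theorem fderiv_probeConv_apply (hR : 0 < R) (y a : (EuclideanSpace ℝ (Fin 3))) :
    fderiv ℝ (probeBump R ⋆ φ.normed volume) y a =
      ((fun z => fderiv ℝ (probeBump R) z a) ⋆ φ.normed volume) y :=
  ConvolutionLaplacian.fderiv_convolution_left_apply (hasCompactSupport_probeBump hR)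
    (contDiff_probeBump R) φ.continuous_normed.locallyIntegrable y a

/-- **`ΔΦ = (Δχ_R) ⋆ θ`.** [folklore] -/
theorem laplacian_probeConv (hR : 0 < R) (y : (EuclideanSpace ℝ (Fin 3))) :
    (Δ (probeBump R ⋆ φ.normed volume)) y = ((Δ (probeBump (E := (EuclideanSpace ℝ (Fin 3))) R)) ⋆ φ.normed volume) y :=
  ConvolutionLaplacian.laplacian_convolution_left (hasCompactSupport_probeBump hR)
    (contDiff_probeBump R) φ.continuous_normed.locallyIntegrable y

/-- `Φ` vanishes for `‖y‖ > 2R + rOut`. [folklore] -/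
theorem probeConv_eq_zero (hR : 0 < R) {y : (EuclideanSpace ℝ (Fin 3))} (hy : 2 * R + φ.rOut < ‖y‖) :
    (probeBump R ⋆ φ.normed volume) y = 0 :=
  ConvolutionLaplacian.convolution_eq_zero_of_lt_norm (fun _ hz => probeBump_eq_zero_of_lt hR hz)
    (fun _ hz => normed_eq_zero_of_lt φ hz) hy

/-- `∂ₐΦ` vanishes for `‖y‖ > 2R + rOut`. [folklore] -/
theorem fderiv_probeConv_apply_eq_zero (hR : 0 < R) {y : (EuclideanSpace ℝ (Fin 3))} (hy : 2 * R + φ.rOut < ‖y‖) (a : (EuclideanSpace ℝ (Fin 3))) :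
    fderiv ℝ (probeBump R ⋆ φ.normed volume) y a = 0 := by
  rw [fderiv_probeConv_apply φ hR]
  refine ConvolutionLaplacian.convolution_eq_zero_of_lt_norm (fun z hz => ?_)
    (fun _ hz => normed_eq_zero_of_lt φ hz) hy
  have : fderiv ℝ (probeBump R) z = 0 := by
    refine fderiv_of_notMem_tsupport ℝ fun hmem => ?_
    have := tsupport_probeBump_subset hR hmem
    rw [mem_closedBall_zero_iff] at this
    linarith
  rw [this]; rfl

/-- `ΔΦ` vanishes for `‖y‖ > 2R + rOut`. [folklore] -/
theorem laplacian_probeConv_eq_zero (hR : 0 < R) {y : (EuclideanSpace ℝ (Fin 3))} (hy : 2 * R + φ.rOut < ‖y‖) :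
    (Δ (probeBump R ⋆ φ.normed volume)) y = 0 := by
  rw [laplacian_probeConv φ hR]
  refine ConvolutionLaplacian.convolution_eq_zero_of_lt_norm (fun z hz => ?_)
    (fun _ hz => normed_eq_zero_of_lt φ hz) hy
  refine FluidPDE.laplacian_eq_zero_of_notMem_tsupport fun hmem => ?_
  have := tsupport_probeBump_subset hR hmem
  rw [mem_closedBall_zero_iff] at this
  linarith

/-- `|Φ| ≤ (m R³)⁻¹`. [folklore] -/
theorem abs_probeConv_le (hR : 0 < R) (y : (EuclideanSpace ℝ (Fin 3))) :
    |(probeBump R ⋆ φ.normed volume) y| ≤ (baseBumpMass (EuclideanSpace ℝ (Fin 3)) * R ^ 3)⁻¹ := by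
  have hd : Module.finrank ℝ (EuclideanSpace ℝ (Fin 3)) = 3 := finrank_euclideanSpace_fin
  refine ConvolutionLaplacian.abs_convolution_le (fun z => ?_) φ.nonneg_normed φ.integrable_normed
    φ.integral_normed y
  have := abs_probeBump_le (E := (EuclideanSpace ℝ (Fin 3))) hR z
  rwa [hd] at this

/-- `|∂ₐΦ| ≤ (m R³)⁻¹ R⁻¹ C₁ ‖a‖` for a bound `C₁` of `‖Dθ₀‖` (`θ₀` the base bump). [folklore] -/
theorem abs_fderiv_probeConv_apply_le (hR : 0 < R) {C₁ : ℝ}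
    (hC₁ : ∀ x : (EuclideanSpace ℝ (Fin 3)), ‖fderiv ℝ baseBump x‖ ≤ C₁) (y a : (EuclideanSpace ℝ (Fin 3))) :
    |fderiv ℝ (probeBump R ⋆ φ.normed volume) y a| ≤
      (baseBumpMass (EuclideanSpace ℝ (Fin 3)) * R ^ 3)⁻¹ * R⁻¹ * C₁ * ‖a‖ := by
  have hd : Module.finrank ℝ (EuclideanSpace ℝ (Fin 3)) = 3 := finrank_euclideanSpace_fin
  rw [fderiv_probeConv_apply φ hR]
  refine ConvolutionLaplacian.abs_convolution_le (fun z => ?_) φ.nonneg_normed φ.integrable_normed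
    φ.integral_normed y
  have h1 := norm_fderiv_probeBump_le (E := (EuclideanSpace ℝ (Fin 3))) hR hC₁ z
  rw [hd] at h1
  rw [← Real.norm_eq_abs]
  exact (ContinuousLinearMap.le_opNorm _ _).trans (mul_le_mul_of_nonneg_right h1 (norm_nonneg _))

/-- `‖DΦ(y)‖ ≤ (m R³)⁻¹ R⁻¹ C₁` (operator norm). [folklore] -/
theorem norm_fderiv_probeConv_le (hR : 0 < R) {C₁ : ℝ}
    (hC₁ : ∀ x : (EuclideanSpace ℝ (Fin 3)), ‖fderiv ℝ baseBump x‖ ≤ C₁) (y : (EuclideanSpace ℝ (Fin 3))) :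
    ‖fderiv ℝ (probeBump R ⋆ φ.normed volume) y‖ ≤ (baseBumpMass (EuclideanSpace ℝ (Fin 3)) * R ^ 3)⁻¹ * R⁻¹ * C₁ := by
  have hC₁0 : 0 ≤ C₁ := (norm_nonneg _).trans (hC₁ 0)
  have hm := baseBumpMass_pos (E := (EuclideanSpace ℝ (Fin 3)))
  refine ContinuousLinearMap.opNorm_le_bound _ (by positivity) fun a => ?_
  rw [Real.norm_eq_abs]
  exact abs_fderiv_probeConv_apply_le φ hR hC₁ y a

/-- `|ΔΦ| ≤ (m R³)⁻¹ R⁻² C₂` for a bound `C₂` of `|Δθ₀|`. [folklore] -/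
theorem abs_laplacian_probeConv_le (hR : 0 < R) {C₂ : ℝ}
    (hC₂ : ∀ x : (EuclideanSpace ℝ (Fin 3)), |(Δ (baseBump : (EuclideanSpace ℝ (Fin 3)) → ℝ)) x| ≤ C₂) (y : (EuclideanSpace ℝ (Fin 3))) :
    |(Δ (probeBump R ⋆ φ.normed volume)) y| ≤ (baseBumpMass (EuclideanSpace ℝ (Fin 3)) * R ^ 3)⁻¹ * R⁻¹ ^ 2 * C₂ := by
  have hd : Module.finrank ℝ (EuclideanSpace ℝ (Fin 3)) = 3 := finrank_euclideanSpace_fin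
  rw [laplacian_probeConv φ hR]
  refine ConvolutionLaplacian.abs_convolution_le (fun z => ?_) φ.nonneg_normed φ.integrable_normed
    φ.integral_normed y
  have := abs_laplacian_probeBump_le (E := (EuclideanSpace ℝ (Fin 3))) hR hC₂ z
  rwa [hd] at this

end TestFunction

/-! ### The probe identity for the mollified harmonic part -/

/-- The momentum equation of the unforced system solved for the pressure gradient (open time
set). [folklore] -/
theorem gradient_pressure_eq (h : IsClassicalNSSolutionOn S ν 0 u p) {t : ℝ} (ht : t ∈ S)
    (y : (EuclideanSpace ℝ (Fin 3))) :
    gradient (p t) y = ν • (Δ (u t)) y - FluidPDE.timeDerivWithin S u t y -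
      FluidPDE.convect (u t) (u t) y := by
  have hm := h.momentum t ht y
  simp only [Pi.zero_apply, add_zero] at hm
  calc gradient (p t) y = ν • (Δ (u t)) y -
        (FluidPDE.timeDerivWithin S u t y + FluidPDE.convect (u t) (u t) y) := by
          rw [hm]; abel
    _ = _ := by abel

/-- **The probe identity** (Tao 2011, §4, proof of Lemma 4.1 (i), the computation of
`∫∫ ∇h χ_R`, for the mollified harmonic part of an `L³` solution). Let `(u, p)` be a classical
solution of the unforced system on an open time set `S`, `t ∈ S`, `u(t) ∈ L³`, `θ = φ.normed`
a normed bump, `R > 0`, and `Φ = χ_R ⋆ θ`. Then for every centre `x₀` and direction `a`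
`∂ₐ(θ ⋆ (p(t) − Π[u(t)]))(x₀) = ν ∫⟪u, ΔΨ⟫ + ∫⟪u, (u·∇)Ψ⟫ − ∫⟪∂ₜu, Ψ⟫ − ∫ ∂ₐΦ(y) Π[u(t)](x₀ − y) dy`,
`Ψ(y) = Φ(x₀ − y) a`. [cite: Tao2011, §4, proof of Lemma 4.1 (i)] -/
theorem fderiv_mollified_harmonicPart_eq (h : IsClassicalNSSolutionOn S ν 0 u p) (hS : IsOpen S)
    {t : ℝ} (ht : t ∈ S) (h3 : MemLp (u t) 3 volume) (φ : ContDiffBump (0 : (EuclideanSpace ℝ (Fin 3)))) {R : ℝ}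
    (hR : 0 < R) (x₀ a : (EuclideanSpace ℝ (Fin 3))) :
    fderiv ℝ (φ.normed volume ⋆ fun x => p t x - rieszPressure (u t) x) x₀ a =
      ν * (∫ y, ⟪u t y, (Δ (fun y => (probeBump R ⋆ φ.normed volume) (x₀ - y))) y • a⟫)
      + (∫ y, ⟪u t y,
          fderiv ℝ (fun y => (probeBump R ⋆ φ.normed volume) (x₀ - y)) y (u t y) • a⟫)
      - (∫ y, ⟪FluidPDE.timeDerivWithin S u t y, (probeBump R ⋆ φ.normed volume) (x₀ - y) • a⟫)
      - ∫ y, fderiv ℝ (probeBump R ⋆ φ.normed volume) y a * rieszPressure (u t) (x₀ - y) := by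
  haveI : CompleteSpace (EuclideanSpace ℝ (Fin 3)) := inferInstance
  -- names
  set g : (EuclideanSpace ℝ (Fin 3)) → ℝ := fun x => p t x - rieszPressure (u t) x with hg_def
  set θ : (EuclideanSpace ℝ (Fin 3)) → ℝ := φ.normed volume with hθ_def
  set χ : (EuclideanSpace ℝ (Fin 3)) → ℝ := probeBump R with hχ_def
  set Φ : (EuclideanSpace ℝ (Fin 3)) → ℝ := χ ⋆ θ with hΦ_def
  -- regularity of the data
  have hu : ContDiff ℝ ∞ (u t) := h.contDiff_velocity ht
  have hp : ContDiff ℝ ∞ (p t) := h.contDiff_pressure ht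
  have hu2 : ContDiff ℝ 2 (u t) := contDiff_infty.1 hu 2
  have hu1 : ContDiff ℝ 1 (u t) := contDiff_infty.1 hu 1
  have hp1 : ContDiff ℝ 1 (p t) := contDiff_infty.1 hp 1
  have huc : Continuous (u t) := hu.continuous
  have hPi : MemLp (rieszPressure (u t)) (3 / 2 : ℝ≥0∞) volume := memLp_rieszPressure h3
  have hPiloc : LocallyIntegrable (rieszPressure (u t)) volume :=
    hPi.locallyIntegrable one_le_three_halves
  have hgloc : LocallyIntegrable g volume := locallyIntegrable_harmonicPart h ht h3
  have hθs : ContDiff ℝ ∞ θ := φ.contDiff_normed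
  have hθc : HasCompactSupport θ := φ.hasCompactSupport_normed
  have hχs : ContDiff ℝ ∞ χ := contDiff_probeBump R
  have hχc : HasCompactSupport χ := hasCompactSupport_probeBump hR
  have hχ1 : ContDiff ℝ 1 χ := contDiff_infty.1 hχs 1
  have hΦs : ContDiff ℝ ∞ Φ := contDiff_probeConv φ hR
  have hΦc : HasCompactSupport Φ := hasCompactSupport_probeConv φ hR
  have hΦ1 : ContDiff ℝ 1 Φ := contDiff_infty.1 hΦs 1
  have hΦ2 : ContDiff ℝ 2 Φ := contDiff_infty.1 hΦs 2
  -- Step 1: mean-value formula for the gradient of the harmonic function `θ ⋆ g`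
  have hη := harmonicOnNhd_mollified_harmonicPart h hS ht h3 hθs hθc
  rw [fderiv_harmonic_eq_integral_probeBump hη hR x₀ a]
  -- Step 2: `∫ ∂ₐχ_R(z) (θ ⋆ g)(x₀ - z) dz = ((∂ₐχ_R ⋆ θ) ⋆ g)(x₀) = ∫ ∂ₐΦ(y) g(x₀ - y) dy`
  have hχa : Continuous fun z => fderiv ℝ χ z a :=
    (hχ1.continuous_fderiv one_ne_zero).clm_apply continuous_const
  have hχac : HasCompactSupport fun z => fderiv ℝ χ z a := hχc.fderiv_apply (𝕜 := ℝ) a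
  have e1 : ∫ z, fderiv ℝ χ z a * (θ ⋆ g) (x₀ - z) = ((fun z => fderiv ℝ χ z a) ⋆ (θ ⋆ g)) x₀ := by
    rw [convolution_lsmul]
    rfl
  have e2 : ((fun z => fderiv ℝ χ z a) ⋆ (θ ⋆ g)) x₀ = (((fun z => fderiv ℝ χ z a) ⋆ θ) ⋆ g) x₀ :=
    (ConvolutionLaplacian.convolution_assoc_of_hasCompactSupport hχa hχac φ.continuous_normed hθc
      hgloc x₀).symm
  have e3 : (fun z => fderiv ℝ χ z a) ⋆ θ = fun y => fderiv ℝ Φ y a :=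
    funext fun y => (fderiv_probeConv_apply φ hR y a).symm
  rw [e1, e2, e3, convolution_lsmul]
  simp only [smul_eq_mul]
  -- Step 3: split `g = p - Π`
  have hΦa : Continuous fun y => fderiv ℝ Φ y a :=
    (hΦ1.continuous_fderiv one_ne_zero).clm_apply continuous_const
  have hΦac : HasCompactSupport fun y => fderiv ℝ Φ y a := hΦc.fderiv_apply (𝕜 := ℝ) a
  have iP : Integrable fun y => fderiv ℝ Φ y a * p t (x₀ - y) :=
    (hΦa.mul (hp.continuous.comp (continuous_const.sub continuous_id))).integrable_of_hasCompactSupport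
      hΦac.mul_right
  have iQ : Integrable fun y => fderiv ℝ Φ y a * rieszPressure (u t) (x₀ - y) :=
    (hΦac.convolutionExists_left (lsmul ℝ ℝ : ℝ →L[ℝ] ℝ →L[ℝ] ℝ) hΦa hPiloc x₀).integrable
  have e4 : ∫ y, fderiv ℝ Φ y a * g (x₀ - y) =
      (∫ y, fderiv ℝ Φ y a * p t (x₀ - y)) - ∫ y, fderiv ℝ Φ y a * rieszPressure (u t) (x₀ - y) := by
    rw [← integral_sub iP iQ]
    refine integral_congr_ae (Eventually.of_forall fun y => ?_)
    simp only [hg_def, mul_sub]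
  rw [e4]
  -- Step 4: the pressure part through the momentum equation
  -- the test field `Ψ(y) = Φ(x₀ - y) a`
  set ψ : (EuclideanSpace ℝ (Fin 3)) → ℝ := fun y => Φ (x₀ - y) with hψ_def
  have hψs : ContDiff ℝ ∞ ψ := hΦs.comp (contDiff_const.sub contDiff_id)
  have hψ2 : ContDiff ℝ 2 ψ := contDiff_infty.1 hψs 2
  have hψ1 : ContDiff ℝ 1 ψ := contDiff_infty.1 hψs 1
  have hψc : HasCompactSupport ψ := hΦc.comp_homeomorph (Homeomorph.subLeft x₀)
  set Ψ : (EuclideanSpace ℝ (Fin 3)) → (EuclideanSpace ℝ (Fin 3)) := fun y => ψ y • a with hΨ_def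
  have hΨ2 : ContDiff ℝ 2 Ψ := hψ2.smul contDiff_const
  have hΨ1 : ContDiff ℝ 1 Ψ := hψ1.smul contDiff_const
  have hΨc : HasCompactSupport Ψ := hψc.smul_right (f' := fun _ => a)
  have hΨcont : Continuous Ψ := hΨ1.continuous
  have hDΨ : ∀ y w, fderiv ℝ Ψ y w = (fderiv ℝ ψ y w) • a := fun y w => by
    simp only [hΨ_def]
    rw [fderiv_smul_const (hψ1.differentiable one_ne_zero y), ContinuousLinearMap.smulRight_apply]
  have hΔΨ : ∀ y, (Δ Ψ) y = (Δ ψ) y • a := fun y => by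
    have e : Ψ = (ContinuousLinearMap.toSpanSingleton ℝ a) ∘ ψ := by
      funext w; simp [hΨ_def, ContinuousLinearMap.toSpanSingleton_apply]
    rw [e, hψ2.contDiffAt.laplacian_CLM_comp_left]
    simp [ContinuousLinearMap.toSpanSingleton_apply]
  -- continuity of the slices entering the momentum equation
  have hΔuc : Continuous (Δ (u t)) := FluidPDE.continuous_laplacian hu2
  have hdtc : Continuous (FluidPDE.timeDerivWithin S u t) :=
    ((h.smooth_velocity.timeDerivWithin hS.uniqueDiffOn).contDiff_slice ht).continuous
  have hcvc : Continuous (FluidPDE.convect (u t) (u t)) :=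
    (hu1.continuous_fderiv one_ne_zero).clm_apply huc
  -- integration by parts, then change of variables `y ↦ x₀ - y`
  have e5 : ∫ y, fderiv ℝ Φ y a * p t (x₀ - y) = ∫ y, ⟪gradient (p t) y, Ψ y⟫ := by
    rw [integral_fderiv_mul_comp_sub hΦ1 hΦc hp1 x₀ a,
      ← integral_sub_left_eq_self (fun y => Φ y * fderiv ℝ (p t) (x₀ - y) a) volume x₀]
    refine integral_congr_ae (Eventually.of_forall fun y => ?_)
    have hgr : ⟪gradient (p t) y, a⟫ = fderiv ℝ (p t) y a := by
      rw [real_inner_comm, inner_gradient_eq_fderiv_apply]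
    simp only [sub_sub_cancel, hΨ_def, hψ_def, inner_smul_right, hgr]
  have iL := FluidPDE.integrable_inner_of_hasCompactSupport_right hΔuc hΨcont hΨc
  have iT := FluidPDE.integrable_inner_of_hasCompactSupport_right hdtc hΨcont hΨc
  have iC := FluidPDE.integrable_inner_of_hasCompactSupport_right hcvc hΨcont hΨc
  have e6 : ∫ y, ⟪gradient (p t) y, Ψ y⟫ =
      ν * (∫ y, ⟪(Δ (u t)) y, Ψ y⟫) - (∫ y, ⟪FluidPDE.timeDerivWithin S u t y, Ψ y⟫) -
        ∫ y, ⟪FluidPDE.convect (u t) (u t) y, Ψ y⟫ := by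
    have key : ∀ y, ⟪gradient (p t) y, Ψ y⟫ = ν * ⟪(Δ (u t)) y, Ψ y⟫ -
        ⟪FluidPDE.timeDerivWithin S u t y, Ψ y⟫ - ⟪FluidPDE.convect (u t) (u t) y, Ψ y⟫ := by
      intro y
      rw [gradient_pressure_eq h ht y, inner_sub_left, inner_sub_left, inner_smul_left]
      simp
    have i2 : Integrable fun y => ν * ⟪(Δ (u t)) y, Ψ y⟫ := iL.const_mul ν
    have i1 : Integrable fun y => ν * ⟪(Δ (u t)) y, Ψ y⟫ -
        ⟪FluidPDE.timeDerivWithin S u t y, Ψ y⟫ := i2.sub iT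
    rw [integral_congr_ae (Eventually.of_forall key), integral_sub i1 iC, integral_sub i2 iT,
      integral_const_mul]
  -- Green's identity for the viscous term
  have e7 : ∫ y, ⟪(Δ (u t)) y, Ψ y⟫ = ∫ y, ⟪u t y, (Δ ψ) y • a⟫ := by
    rw [FluidPDE.integral_inner_laplacian_comm hu2 hΨ2 hΨc]
    exact integral_congr_ae (Eventually.of_forall fun y => by
      show ⟪u t y, (Δ Ψ) y⟫ = ⟪u t y, (Δ ψ) y • a⟫
      rw [hΔΨ y])
  -- the trilinear identity for the transport term
  have e8 : ∫ y, ⟪FluidPDE.convect (u t) (u t) y, Ψ y⟫ =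
      -∫ y, ⟪u t y, fderiv ℝ ψ y (u t y) • a⟫ := by
    have h0 := FluidPDE.integral_inner_convect_add_eq_zero hu1 hu1 hΨ1 hΨc
    have hz : ∫ y, VectorCalculus.divergence (u t) y * ⟪u t y, Ψ y⟫ = 0 := by
      simp [h.divFree t ht _]
    have hc : ∫ y, ⟪u t y, FluidPDE.convect (u t) Ψ y⟫ = ∫ y, ⟪u t y, fderiv ℝ ψ y (u t y) • a⟫ :=
      integral_congr_ae (Eventually.of_forall fun y => by simp only [FluidPDE.convect, hDΨ])
    linarith
  rw [e5, e6, e7, e8]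
  ring

end PressureNormalisationL3

end Literature.Analysis.FluidPDE

end
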